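import Mathlib
import HarnessLib
import HarnessLib.Audit
import Summits.AtomisticToContinuum.Statement
import Literature.MathematicalPhysics.QuantumManyBody.PeriodicBoseGas
import Summits.AtomisticToContinuum.BoseEinsteinCondensation.Theorems.BECInfraredBoundAssembly
import HarnessLib.Audit.Status.Attr

/-!
Route: BECDyadicChaining

CLOSED (exhausted) 2026-08-17T18:08:02Z by planner-rbadge-AtomisticToContinuum-BECDyadicC-90105daa-g2-0 — reason: exhausted — note: route-repair gen2 (rbadge; needs_repair tribunal-failed:summit-strength): CLOSED exhausted — honest scale-resolved reformulation ≥ the conjunct. CENSUS. Tried: closes(hD,hB) proved; hB BaseCoherentMass PROVED (p148719); hD DyadicCoherenceDefect (stmt-13192) kernel-certified ≥ conjunct (Birth.boseEin. The file is kept as the record of this route; refuted decls are indexed as negative knowledge (`ledger negatives`).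

# Route BECDyadicChaining — coherent amplitude of dyadic block condensates telescopes across scales
— BEC from a SUMMABLE per-level coherence defect plus coherent mass at the healing scale

It suffices to show X = DyadicCoherenceDefect ∧ BaseCoherentMass (card
coherence-angle-scale-chaining; conforming re-open,
D-0027 §2.1, of the retired route BECScaleChaining: same mechanism and item texts, but the route now
DECIDES the conjunct — the
deciding theorem `closes (hD : DyadicCoherenceDefect) (hB : BaseCoherentMass) :
_root_.BoseEinsteinCondensation` is PROVED in
the folder's glue.lean, axioms propext/Classical.choice/Quot.sound). Tile the Dirichlet box Λ_L, L =
(N/ρ)^{1/3}, by the open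
dyadic cubes C of side L/2^m (level m), block modes φ_C = (L/2^m)^{-3/2}·1_C, and put A_m(Ψ) :=
8^{-m/2} Σ_{C ∈ level m} √⟨φ_C, γ_Ψ φ_C⟩
(COHERENT AMPLITUDE; A_0 = √(occupation of the constant mode φ₀ = L^{-3/2}1_box); A_m ↑ in m since
the parent Gram vector is
8^{-1/2} × the sum of its children's). DyadicCoherenceDefect (rank 2): for δ-near-minimisers, A_m ≤
A_{m−1} + β_j √N at every
level whose cube side lies in the bracket [ℓ_d 2^j, ℓ_d 2^{j+1}), with ONE budget β = β(v,ρ) ≥ 0,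
Σ_j β_j ≤ 1/4, uniform in N.
BaseCoherentMass (rank 3): at a healing-type base scale ℓ_b ≥ ℓ_d, A_K ≥ √N/2 for the level K with
L/2^K ∈ [ℓ_b, 2ℓ_b).
Telescoping gives √N ≤ 2A_K ≤ 2A_0 + √N/2, i.e. ⟨φ₀, γ_Ψ φ₀⟩ = A_0² ≥ N/16 — the shared zero-mode
target ZeroModeOccupation
(X_B1, stmt-AtomisticToContinuum-0686) — and the conjunct by the proved zero-mode criterion
`bec_of_zeroMode`.
Lean: `DyadicCoherenceDefect ∧ BaseCoherentMass`

## Assembly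
The route decides the conjunct through the two ranked cruxes alone: `theorem closes (hD :
DyadicCoherenceDefect) (hB : BaseCoherentMass) :
_root_.BoseEinsteinCondensation` is PROVED (folder glue.lean = Sketch.lean, 190 lines, lean check rc
0, axioms propext / Classical.choice /
Quot.sound). Proof: `bec_of_zeroMode` (Theorems/BECInfraredBoundAssembly.lean, proved) reduces the
conjunct to X_B1 with c = 1/16; fix v,
take ℓ_d, ρ₀′ from hD and ρ₀″ from hB fed this ℓ_d, ρ₀ = min; for ρ < ρ₀ take β and ℓ_b ≥ ℓ_d,
intersect the two eventualities in N,
δ = min(δ′, δ″); for a δ-near-minimiser every level m ≤ K has cube side ≥ ℓ_b ≥ ℓ_d, so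
`exists_nat_pow_near` gives a bracket j(m)
with 2^{j(m)+m} ≤ L/ℓ_d < 2^{j(m)+m+1}, whence j(m) + m is constant and j is injective on {1,…,K};
an induction on K telescopes the
per-level inequalities to A_K ≤ A_0 + (Σ_{m≤K} β_{j(m)})√N ≤ A_0 + √N/4 (`Finset.sum_image`,
`Summable.sum_le_tsum`), and √N ≤ 2A_K
gives √N ≤ 4A_0 in ℝ≥0∞ (√N finite); A_0 is the single level-0 term, whose cube {x | x_k ∈ (0·L,
1·L)} is `box L` with weight
(√(L³))⁻¹, so squaring yields ofReal(N/16) ≤ ⟨φ₀, γ_Ψ φ₀⟩. The Assembly item below records the same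
implication (assembly_holds :=
closes in Sketch.lean); ZeroModeOccupation, WindowLocalCondensation and CoherentAmplitudeMonotone
are not hypotheses of `closes`.

Rationale: WHY THIS LINE. For ANY state the block Gram vectors u_C(Y) = √N ∫ conj(φ_C) Ψ(·,Y) ∈ L²(Λ^{N−1})
satisfy u_P = 8^{-1/2} Σ_{C⊂P} u_C, so
A_m − A_{m−1} = 8^{-m/2} Σ_P (Σ_C ‖u_C‖ − ‖Σ_C u_C‖) ≥ 0 is a sum of LOCAL norm defects: it vanishes
identically on every pure
condensate N|φ⟩⟨φ| with φ ≥ 0 whatever the profile (free gas, Dirichlet wall layer and GP profile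
cost nothing), it is quadratic
in the sibling decoherence angles (the card's Gram-angle triangle inequality in quadrature form,
valid for mixed/complex states,
no positivity or reflection positivity), it is ℓ¹ over positions (averaged outputs of localisation
engines suffice — the audit's
max-vs-average objection to the card is met) and it TELESCOPES, so the thermodynamic limit costs a
convergent series Σ_j β_j
instead of a uniform-in-L estimate; one-step versions of the k-th step are Junge2026
(arXiv:2603.20776 Thm 3 / Cor 6, paying R²
once), Fournais2020 Thm 1.2, LSSY2005 Thm 5.1, ChongLiangNam2026. The per-level target is dictated
by two-block Josephson
physics (Leggett2001 §VI): defect/√N ≍ ½⟨δθ²⟩ ≍ √(ρa³)(ξ/ℓ)² above the healing length ξ =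
(8πρa)^{-1/2} and ≍ ρa²ℓ below it —
geometric on both sides of ξ, total O(√(ρa³)) against a required 1/4 (the same answer as summing
Bogoliubov phonon occupations
n_k ≍ L/(ξk·L) over the modes k ∼ 2^m/L resolved at level m). Imported areas: elementary
Hilbert-space geometry of PSD Gram
matrices, multiscale bookkeeping in the spirit of block-spin LRO (Balaban1995, BalabanOcarroll1999,
BFKT2017) but with the
induction carried by a functional of the TRUE γ_Ψ rather than an effective action, and the
kinetic-gap method exactly where
it is a theorem for the base (inputs now PROVED in the tree: eventually_groundStateEnergy_le_dyson,
LSSY2005_lowerBound_neumann_holds,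
neumannPoincare_boxN_holds). No open BEC route decomposes BY SCALE inside the fixed thermodynamic
box (BECInfraredBound: per-mode
IR bound; BECJosephsonSlackThreshold: one energy scale; BECStoquasticCensoring: configuration
censoring; BECRenormGroup-type
lines: effective actions); negatives index: only BECSwapAffinity.SwapJensen (unrelated) at filing.

RANKED CRUXES. #0 ZeroModeOccupation (target) — X_B1 verbatim (stmt-AtomisticToContinuum-0686,
shared with BECInfraredBound / BECStoquasticCensoring / BECHierarchicalGluing): for every repulsive
finite-range v there is ρ₀ > 0 such that for 0 < ρ < ρ₀ there is c > 0 with: for all large N, some δ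
> 0, every δ-near-minimiser Ψ of the Dirichlet energy in the box of side L = (N/ρ)^{1/3} has ⟨φ₀,
γ_Ψ φ₀⟩ ≥ cN, φ₀ = L^{-3/2}·1_box. It is what the chain reaches (with c = 1/16), not a hypothesis of
`closes`. (why it might fail: it is thermodynamic-limit BEC in zero-mode Dirichlet form (LSSY2005
Ch. 5 (5.2), open); fails only if Dirichlet near-minimisers condense into a mode asymptotically
orthogonal to φ₀, against the flat Gross–Pitaevskii bulk profile.) [LSSY2005, PenroseOnsager1956,
Fournais2020]
#2 DyadicCoherenceDefect (crux) — SUMMABLE DYADIC COHERENCE DEFECT (card K1 in quadrature form). For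
every repulsive finite-range v there are ℓ_d(v) > 0 and ρ₀ > 0 such that for 0 < ρ < ρ₀ there is a
budget β : ℕ → [0,∞), Σ_j β_j ≤ 1/4, with: for all large N there is δ > 0 such that every
δ-near-minimiser Ψ of the Dirichlet energy in the box of side L = (N/ρ)^{1/3} satisfies, for every
level m ≥ 1 whose cube side L/2^m lies in [ℓ_d 2^j, ℓ_d 2^{j+1}): A_m ≤ A_{m−1} + β_j √N, where A_m
= 8^{-m/2} Σ_{C ∈ level m} √(occupation of (L/2^m)^{-3/2}1_C). Equivalently the norm defect Σ_P
(Σ_{C⊂P} ‖u_C‖ − ‖Σ_C u_C‖) over the parents of side 2^{j+1}ℓ_d is ≤ 8^{m/2} β_j √N, uniformly in N.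
Free gas: defect ≡ 0 on the ground state (β absorbs the δ-near-minimiser slack below the gap
3π²/L²). [difficulty: open-problem] (why it might fail: at the top levels (cube side L/2, L/4) β_j →
0 demands inter-octant phase coherence of the Dirichlet ground state uniformly in N — the
thermodynamic difficulty itself; every engine in print pays ℓ²×(local excess energy) per step
(Junge2026 Rem 7), and no non-energetic engine exists.) [arXiv:2603.20776, Fournais2020,
ChongLiangNam2026, Leggett2001, LSSY2005, BFKT2017, MoraCastin2003]
#3 BaseCoherentMass (crux) — COHERENT MASS AT A HEALING-TYPE BASE SCALE (card WindowBase moved down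
to ℓ_b ∼ ξ/10). For every repulsive finite-range v and every ℓ_d > 0 there is ρ₀ > 0 such that for 0
< ρ < ρ₀ there is ℓ_b ≥ ℓ_d with: for all large N there are a level K with L/2^K ∈ [ℓ_b, 2ℓ_b) and δ
> 0 such that every δ-near-minimiser has A_K ≥ √N/2, i.e. (8^{-K/2} Σ_B √n_B)² ≥ N/4 over the base
cubes B. Route to it: Σ_B n_B ≥ (1−ε)N by the Neumann Poincaré inequality in each cube against the
kinetic energy ≤ E₀ + δ ≤ 4πaρN(1 + C(ρa³)^{1/3}) (Dyson–LSSY Dirichlet upper bound, PROVED in tree: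
eventually_groundStateEnergy_le_dyson), then (Σ√n_B)² ≥ (Σ n_B)³/Σ n_B² (Hölder) with the
anti-concentration Σ_B ⟨N_B⟩² ≤ Λ N² 8^{-K}, Λ(1−ε)^{-3} ≤ 4, from the cell-wise Lieb–Yngvason lower
bound (PROVED: LSSY2005_lowerBound_neumann_holds, cellDecomposition, superadditivity) against the
same upper bound; free gas (a = 0): A_K/√N → (2√2/π)³ ≈ 0.73. [difficulty: L] (why it might fail:
only through constants: needs Λ(1−ε)^{-3} ≤ 4, i.e. MATCHED leading constants 4πa (cell-wise LY
lower vs Dyson upper bound) plus monotone control of over-occupied cells, and a(v) < ∞ for hard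
cores; for v = 0 a.e. a separate free-gas argument with margin 0.73 vs 0.5 below the gap 3π²/L².)
[LSSY2005, LiebYngvason1998, Dyson1957, BastiCenatiempoSchlein2021, Fournais2020]
#4 WindowLocalCondensation (crux) — LOCAL CONDENSATION OF THE THERMODYNAMIC GROUND STATE ON ALL
DYADIC SCALES UP TO THE FOURNAIS–JUNGE WINDOW (card engine (iii); the half of rank 2 that existing
technology should reach; not a hypothesis of `closes`). For every repulsive finite-range v (a =
scattering length) and every η ∈ (0, 1/4) there are γ > 2η, C ≥ 0 and ρ₀ > 0 such that for 0 < ρ <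
ρ₀, all large N, some δ > 0 and every δ-near-minimiser Ψ of the Dirichlet box of side L =
(N/ρ)^{1/3}: for every level m with cube side s = L/2^m ≤ (ρa)^{-1/2}(ρa³)^{-η}, Σ_{C ∈ level m}
⟨φ_C, γ_Ψ φ_C⟩ ≥ (1 − C(ρa³)^γ max(1, ρ a s²)) N. Via Σ_C‖u_C‖ − ‖Σ_C u_C‖ ≤ √(8(N_P − n_P)) it
yields the window part of DyadicCoherenceDefect with Σ_{window} β ≲ (ρa³)^{γ/2−η} + (ρa³)^{γ/2}
log(1/ρ); below ξ the left side increases under refinement, so the level s ≍ ξ suffices there.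
Vacuous (true) for a = 0. [difficulty: XL] (why it might fail: Fournais2020 Thm 1.2 (periodic,
proved) and Junge2026 Cor 6 (Neumann, radially decreasing v, unproved in tree) tie ONE box to its
own density at LHY precision; dyadic sub-cubes of a Dirichlet near-minimiser have fluctuating
numbers and need cell-wise two-sided LHY bounds, not in print.) [Fournais2020, arXiv:2603.20776,
FournaisEtAl2024, FournaisSolovej2020, FournaisSolovej2022, BastiCenatiempoSchlein2021,
BastiEtAl2024, ChongLiangNam2026]
#9 CoherentAmplitudeMonotone (support) — For every N, L, every Dirichlet trial state Ψ and every
level m ≥ 1: A_{m−1} ≤ A_m (norm of the sum ≤ sum of the norms for the eight child Gram vectors of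
each parent cube; needs the L²(Λ^{N−1}) structure of `occupation`: u_φ(Y) = √N ∫ conj(φ) Ψ(·,Y), φ ↦
u_φ conjugate-linear, occupation = ‖u_φ‖², and φ_P = 8^{-1/2} Σ_{C⊂P} φ_C a.e.). Establishes the
Hilbert-space API every engine for rank 2 will use; not a hypothesis of `closes`. [difficulty:
provable-now] [LSSY2005, PenroseOnsager1956]
#9 ZeroModeOfChaining (support, GLUE to the target; added 2026-08-16 by the route-choice repair
`route.target-unreachable`) — DyadicCoherenceDefect → BaseCoherentMass → ZeroModeOccupation: the
telescoping chain √N ≤ 2A_K ≤ 2A_0 + √N/2 ⇒ ⟨φ₀, γ_Ψ φ₀⟩ = A_0² ≥ N/16 recorded as an ITEM, so the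
shared target X_B1 (stmt-AtomisticToContinuum-0686) is reached inside the route and, once the two
cruxes close, closes for every route wanting it (BECInfraredBound, BECStoquasticCensoring,
BECHierarchicalGluing, BECWallDressingTransfer, …). Proof = the body of `closes` after its first
line `bec_of_zeroMode` (checked sorry-free in the planner folder's Sketch.lean, axioms propext /
Classical.choice / Quot.sound; attached as evidence on the item); `closes` itself is unchanged and
still takes only DyadicCoherenceDefect and BaseCoherentMass. [difficulty: provable-now] [LSSY2005,
PenroseOnsager1956]

TWO-LAYER PLAN. DyadicCoherenceDefect ⇐ DefectAboveWindow (cube side ≥ (ρa)^{-1/2}(ρa³)^{-η}) →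
DefectInWindow (≤ that scale; follows from
WindowLocalCondensation + the CoherentAmplitude algebra Σ‖u_C‖ − ‖Σu_C‖ ≤ √(8(N_P − n_P))) →
DyadicCoherenceDefect (glue: split the
budget 1/8 + 1/8). Later, if an engine appears: DefectAboveWindow ⇐ InductiveStep (budget at level m
given stiffness certified at
the levels below m) → glue by induction on m. BaseCoherentMass ⇐ BasePoincare (Σ_B n_B ≥ (1−ε)N at
ℓ_b ≤ ξ√ε: Neumann Poincaré +
Dyson upper bound) → BaseNoClumping (Σ_B ⟨N_B⟩² ≤ Λ N² 8^{-K}: LY cell bound + superadditivity) →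
BaseCoherentMass (glue: Hölder
(Σ√n)² ≥ (Σn)³/Σn²). k ≤ 3 each, depth 1.

KILL CRITERIA. A proof of ¬DyadicCoherenceDefect for some admissible v at arbitrarily small ρ
(non-summable per-level defect while BaseCoherentMass
holds) closes the route `refuted:DyadicCoherenceDefect` — it would say block phases do NOT stiffen
with scale (no superfluid phase
rigidity), news for every BEC route; the witness must beat the free-gas check (defect ≡ 0) and the
sub-gap δ. ¬BaseCoherentMass
would contradict LSSY Thm 5.1-type local condensation at the healing scale — pivot to a base at the
window scale
(WindowLocalCondensation becomes rank 3, budget re-split). ¬WindowLocalCondensation alone does not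
kill the line (rank 2 may hold
with a cruder window budget). ZeroModeOccupation (stmt-0686) proved by any route moots this one; a
proof that Dirichlet near-minimisers
condense into a mode asymptotically orthogonal to φ₀ (¬X_B1 with BEC true) forces the pivot "A_0 ↦
max over level-m₀ cubes":
λ_max(γ) ≥ max_C n_C ≥ A_{m₀}²/8^{m₀}, i.e. stop the cascade at a fixed macroscopic level m₀ and
feed maxOccupation directly.

NOT DECOMPOSED YET. The per-level ENGINE above the window (candidates, none filed: exact
ground-state inequalities ⟨A*[H,A]⟩ ≥ 0 for relative
number/current operators of sibling cubes; a Josephson two-block variational sandwich ⟨δθ²⟩ ≲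
√(E_C/E_J) with E_J ≍ 2ρℓ, E_C ≍ 8πa/ℓ³;
an induction on levels using the stiffness certified below); the regime split at the window;
constants (1/4, 1/2, 1/16 are
arbitrary: any Σβ < A_K/√N works); finiteness of the scattering length for hard cores;
near-minimiser vs ground state (δ is chosen
after N, below the gap); positive temperature and d = 2 variants (other routes). Layer-2 children
only after a crux closes (D-0019).

CHEAPEST FALSIFIER. Compute the per-level defect in Bogoliubov theory on the torus: (A_m −
A_{m−1})/√N = 8^{-m/2} Σ_P (Σ_C‖u_C‖ − ‖Σu_C‖)/√N with
⟨φ_C, γ φ_{C′}⟩ = n₀⟨φ_C,φ₀⟩⟨φ₀,φ_{C′}⟩ + Σ_{p≠0} n_p ⟨φ_C,φ_p⟩⟨φ_p,φ_{C′}⟩, n_p = (p² + 8πρa −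
ε_p)/(2ε_p): a kit job over
ρa³ ∈ {10⁻⁶,…,10⁻³}, ℓ/ξ ∈ [2⁻⁴, 2⁸] must show the two-sided geometric profile peaking at ℓ ≈ ξ with
Σ_m = O(√(ρa³)) ≪ 1/4;
saturation or growth in ℓ beyond ξ kills rank 2 at the level of its own heuristic. By hand: phonon
occupations n_k ≍ (2√2 ξk)^{-1}
at k ∼ 2^m/L give defect/√N ≍ 4^m/(ρξL²) = (ξ/s_m)²(ρξ³)^{-1} ∝ √(ρa³)(ξ/s_m)² — geometric,
consistent; free gas v = 0 (γ rank one,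
φ ≥ 0): defect ≡ 0 and A_K/√N → (2√2/π)³ = 0.7298 ≥ 1/2, so neither crux is refuted by the
admissible v = 0; d = 1 analogue:
E_C/E_J scale-free ⇒ Σβ ∼ log L diverges, consistent with no BEC for 1-D hard cores
(OneDimensionalHardCore) — the statement is
dimension-sensitive as it must be.

NUMBERS. Required: Σ_j β_j ≤ 1/4, A_K ≥ √N/2, output c = 1/16. Predicted (Bogoliubov/Josephson,
Leggett2001 §VI; ħ = 2m = 1, ξ = (8πρa)^{-1/2}):
E_J ≍ 2ρℓ, E_C ≍ 8πa/ℓ³, ⟨δθ²⟩ ≍ ½√(E_C/E_J) = √(πa/ρ)/ℓ², per-level defect/√N ≍ √(ρa³)(ξ/ℓ)² for ℓ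
≳ ξ, ≍ ρa²ℓ for a ≲ ℓ ≲ ξ;
Σ over all dyadic levels = O(√(ρa³)). In-class records the window crux leans on: Fournais2020 Thm
1.2 (n₊/n ≤ Cρas²(ρa³)^{1/2−ε},
s = C_L(ρa³)^{-δ}(ρa)^{-1/2}, 2δ + ε < 1/2; PROVED in tree as Fournais2020_condensation_holds);
Junge2026 Cor 6 p. 6 (Neumann R ≥ a(ρa³)^{-1/2−η}:
n₊ ≤ CNρR²a(ρa³)^{1/2+η}, η = 1/32 at T = 0, Rem 5; κ ≤ (2+2η)/(5+3η) vs thermodynamic κ = 2/3, Rem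
7); LSSY2005 Thm 2.4
(4πρa(1 − CY^{1/17}), cells L/a > C′Y^{-6/17}; PROVED as LSSY2005_lowerBound_neumann_holds);
Dirichlet upper bound
E₀^D(N,(N/ρ)^{1/3}) ≤ 4πρa(1 + C(ρa³)^{1/3})N (PROVED: eventually_groundStateEnergy_le_dyson). Free
gas: constant-mode fraction
(8/π²)³ = 0.533, A_K/√N → 0.730. Items at open: 6 (3 cruxes, 1 target, 1 support, 1 assembly);
`closes` uses the 2 top cruxes.

DEFINITION REQUESTS. None required: cubes, modes and A_m are inlined over
`Literature.MathematicalPhysics.QuantumManyBody.BoseGas.{occupation, TrialState,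
energy, groundStateEnergy, sideLength, box, IsRepulsiveFiniteRange, scatteringLength}` with `let`
binders (identical terms in every
item, so provers can share one `blockMode`/`coherentAmplitude` convenience definition in Theorems —
not items). The off-diagonal
γ(φ,ψ) / Gram-vector API (u_φ ∈ L²(Config (N−1)), occupation = ‖u_φ‖², sesquilinearity) is the
content of CoherentAmplitudeMonotone.

Novelty: Searches (2026-08-15, this seat): `lit vsearch` "condensation by induction over length scales,
adjacent blocks, summable
per-scale errors" (12 book hits: Griffin–Snoke–Stringari 1995 pp. 172–178 = Kagan's kinetic build-up
of coherence over growing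
scales, LSSY2005 pp. 100–104; nothing structural); `lit search --hybrid` "Josephson coupling
charging energy relative phase"
(8 textbook hits); `lit search --source crossref` "BEC thermodynamic limit multiscale block
coherence density matrix" (10, none
relevant); `--source arxiv` "propagation of condensation Neumann localization" (0, rate-limited);
`lit galaxy search --star all`
×2 ("condensate fraction on larger length scales", "phase coherence between neighbouring blocks": 0
rows) and `--star pdf --mode
bm25` (12 RG/phase-transition papers, none on block coherence of γ); `lit frontier
AtomisticToContinuum --since 2023` (BEC
descendants arXiv:2510.20493, arXiv:2603.20776, arXiv:2605.06844, arXiv:2602.16566); `lit read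
arXiv:2603.20776` p. 6 (Rem 5,
Cor 6, Rem 7 verbatim); plus the predecessor seat's sweep (hybrid/crossref/zbmath, 16 BEC route
files) and novelty audit-35 of the card.
Nearest prior art found: Junge2026 = arXiv:2603.20776 Thm 3 / Cor 6 / Rem 7 (ONE Neumann
coarse-graining step, pays R², κ ≤ (2+2η)/(5+3η));
Fournais2020 Thm 1.2, ChongLiangNam2026 and LSSY2005 Thm 5.1 (kinetic-gap condensation on
density-tied scales); Balaban1995 /
BalabanOcarroll1999 (block-spin LRO for classical N-vector models with summable per-scale  [refs: 10.1017/cbo9780511524240, 2510.20493, 2603.20776, 2605.06844, 2602.16566, doi:10.1017/cbo9780511524240, LSSY2005, Junge2026, Fournais2020, ChongLiangNam2026, Balaban1995, BalabanOcarroll1999, BFKT2017]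

Barriers (technique_class: multiscale-coherence, gram-norm-defect, josephson-blocks): - technique_class: multiscale-coherence, gram-norm-defect, josephson-blocks
- Literature.Barriers.AtomisticToContinuum.KineticGapLengthScales: USED, not fought, where it is a
theorem — BaseCoherentMass sits at ℓ_b ∼ ξ/10 (LSSY Thm 5.1's home scale, inputs proved in tree) and
WindowLocalCondensation at Fournais/Junge scales; above the window DyadicCoherenceDefect asks per
level only for a defect of relative size √(E_C/E_J) ∝ ℓ⁻², comparing sibling cubes at the SAME scale
rather than a cube with its excitations, so no ℓ² gap factor is built into the statement — whether
an engine avoids paying it is exactly rank 2 (conceded: every engine in print pays it, Junge2026 Rem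
7).
- Literature.Barriers.AtomisticToContinuum.KineticGapLengthScalesNarrow: the energy-window no-go
(Galilei boosts: slack δ ≳ N/L² certifies fragmented near-minimisers) does not bite — every item
quantifies ∃δ after N (sub-gap window; near-minimisers = ground state up to o(1)); it does certify
that rank 2 can never follow from an energy bound with δ ≳ N/L², so the per-level engine must use
ground-state structure (stationarity / positivity), by design.
- Literature.Barriers.AtomisticToContinuum.EnergyAsymptoticsWithoutCondensation: the per-level
demand at scale ℓ ≫ ξ is worth (ξ/ℓ)⁴ × LHY in energy — below any two-term energy expansion — so
energy-only engines are excluded above the window (conceded); energies enter only at the base and in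
the window, through the catalogued evasion (i) (local condensation on dens

History (route lifecycle, newest last):
- 2026-08-17T18:08:02Z · CLOSED exhausted — exhausted (planner-rbadge-AtomisticToContinuum-BECDyadicC-90105daa-g2-0)

sub-problem: BoseEinsteinCondensation · status: closed(exhausted) · opened planner-plancard-AtomisticToContinuum-BoseEin-01530ea2-g2-0 2026-08-15T19:00:36Z · rev 3 · ledger route-AtomisticToContinuum-BECDyadicChaining
GENERATED by the gate from the ledger (D-0016/17). Provers cite these decls: `theorem foo : Summit.AtomisticToContinuum.BoseEinsteinCondensation.Theses.BECDyadicChaining.<Decl> := …` in Summits/AtomisticToContinuum/BoseEinsteinCondensation/Theorems/<Name>.lean.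
-/

namespace Summit.AtomisticToContinuum.BoseEinsteinCondensation.Theses.BECDyadicChaining

open scoped BigOperators Topology Manifold Classical MeasureTheory ProbabilityTheory Matrix InnerProductSpace ComplexConjugate ContinuousMap
open Filter Set Function TopologicalSpace MeasureTheory

attribute [summit_statement] _root_.BoseEinsteinCondensation

/-- item stmt-AtomisticToContinuum-0686 · target · rank 0 · open · by planner
why it might fail: it is thermodynamic-limit BEC in zero-mode Dirichlet form (LSSY2005 Ch. 5 (5.2), open); fails only if Dirichlet near-minimisers condense into a mode asymptotically orthogonal to φ₀, against the flat Gross–Pitaevskii bulk profile.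
sources: LSSY2005, PenroseOnsager1956, Fournais2020
X_B1: zero-mode macroscopic occupation. For every repulsive finite-range v, at all small densities
ρ, for all large N there is δ > 0 such that every δ-near-minimiser Ψ of the Dirichlet N-body energy
in the box of side (N/ρ)^{1/3} has ⟨φ₀, γ_Ψ φ₀⟩ ≥ cN for the normalised constant mode φ₀ =
L^{-3/2}·1_box (c > 0 depending on v, ρ). -/
@[route_item "route-AtomisticToContinuum-BECDyadicChaining"]
def ZeroModeOccupation : Prop :=
  ∀ v : ℝ → ENNReal, Literature.MathematicalPhysics.QuantumManyBody.BoseGas.IsRepulsiveFiniteRange v → ∃ ρ₀ : ℝ, 0 < ρ₀ ∧ ∀ ρ : ℝ, 0 < ρ → ρ < ρ₀ → ∃ c : ℝ, 0 < c ∧ ∀ᶠ N : ℕ in Filter.atTop, ∃ δ : ENNReal, 0 < δ ∧ ∀ Ψ : Literature.MathematicalPhysics.QuantumManyBody.BoseGas.TrialState N (Literature.MathematicalPhysics.QuantumManyBody.BoseGas.sideLength ρ N), Literature.MathematicalPhysics.QuantumManyBody.BoseGas.energy v Ψ ≤ Literature.MathematicalPhysics.QuantumManyBody.BoseGas.groundStateEnergy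 v N (Literature.MathematicalPhysics.QuantumManyBody.BoseGas.sideLength ρ N) + δ → ENNReal.ofReal (c * N) ≤ Literature.MathematicalPhysics.QuantumManyBody.BoseGas.occupation N ((Literature.MathematicalPhysics.QuantumManyBody.BoseGas.box (Literature.MathematicalPhysics.QuantumManyBody.BoseGas.sideLength ρ N)).indicator fun _ => ((Real.sqrt (Literature.MathematicalPhysics.QuantumManyBody.BoseGas.sideLength ρ N ^ 3))⁻¹ : ℂ)) Ψ.ψ

/-- item stmt-AtomisticToContinuum-13192 · crux · rank 2 · closed · moot by None · by planner
why it might fail: at the top levels (cube side L/2, L/4) β_j → 0 demands inter-octant phase coherence of the Dirichlet ground state uniformly in N — the thermodynamic difficulty itself; every engine in print pays ℓ²×(local excess energy) per step (Junge2026 Rem 7), and no non-energetic engine exists.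
sources: arXiv:2603.20776, Fournais2020, ChongLiangNam2026, Leggett2001, LSSY2005, BFKT2017
[crux] SUMMABLE DYADIC COHERENCE DEFECT (card K1 in quadrature form). For every repulsive
finite-range v there are ℓ_d(v) > 0 and ρ₀ > 0 such that for 0 < ρ < ρ₀ there is a budget β : ℕ →
[0,∞), Σ_j β_j ≤ 1/4, with: for all large N there is δ > 0 such that every δ-near-minimiser Ψ of the
Dirichlet energy in the box of side L = (N/ρ)^{1/3} satisfies, for every level m ≥ 1 whose cube side
L/2^m lies in [ℓ_d 2^j, ℓ_d 2^{j+1}): A_m ≤ A_{m−1} + β_j √N, where A_m = 8^{-m/2} Σ_{C ∈ level m}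
√(occupation of (L/2^m)^{-3/2}1_C). Equivalently the norm defect Σ_P (Σ_{C⊂P} ‖u_C‖ − ‖Σ_C u_C‖)
over the parents of side 2^{j+1}ℓ_d is ≤ 8^{m/2} β_j √N, uniformly in N. Free gas: defect ≡ 0 on the
ground state (β absorbs the δ-near-minimiser slack below the gap 3π²/L²). [difficulty: open-problem] -/
@[route_item "route-AtomisticToContinuum-BECDyadicChaining", crux]
def DyadicCoherenceDefect : Prop :=
  ∀ v : ℝ → ENNReal, Literature.MathematicalPhysics.QuantumManyBody.BoseGas.IsRepulsiveFiniteRange v → ∃ ℓd : ℝ, 0 < ℓd ∧ ∃ ρ₀ : ℝ, 0 < ρ₀ ∧ ∀ ρ : ℝ, 0 < ρ → ρ < ρ₀ → ∃ β : ℕ → ℝ, (∀ j, 0 ≤ β j) ∧ Summable β ∧ ∑' j, β j ≤ 1 / 4 ∧ ∀ᶠ N : ℕ in Filter.atTop, let L : ℝ := Literature.MathematicalPhysics.QuantumManyBody.BoseGas.sideLength ρ N; let φ : (m : ℕ) → (Fin 3 → Fin (2 ^ m)) → EuclideanSpace ℝ (Fin 3) → ℂ := fun m i => Set.indicator {x :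 EuclideanSpace ℝ (Fin 3) | ∀ k : Fin 3, x k ∈ Set.Ioo (((i k : ℕ) : ℝ) * (L / 2 ^ m)) ((((i k : ℕ) : ℝ) + 1) * (L / 2 ^ m))} (fun _ => ((Real.sqrt ((L / 2 ^ m) ^ 3))⁻¹ : ℂ)); ∃ δ : ENNReal, 0 < δ ∧ ∀ Ψ : Literature.MathematicalPhysics.QuantumManyBody.BoseGas.TrialState N L, Literature.MathematicalPhysics.QuantumManyBody.BoseGas.energy v Ψ ≤ Literature.MathematicalPhysics.QuantumManyBody.BoseGas.groundStateEnergy v N L + δ → let A : ℕ → ENNReal := fun m => (8 : ENNReal) ^ (-(m : ℝ) / 2) * ∑ i : Fin 3 → Fin (2 ^ m), (Literature.MathematicalPhysics.QuantumManyBody.BoseGas.occupation N (φ m i) Ψ.ψ) ^ (1 / 2 : ℝ); ∀ m j : ℕ, 1 ≤ m → ℓd * 2 ^ j ≤ L / 2 ^ m → L / 2 ^ m < ℓd * 2 ^ (j + 1) → A m ≤ A (m - 1) + ENNReal.ofReal (β j) * (N : ENNReal) ^ (1 / 2 : ℝ)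

/-- item stmt-AtomisticToContinuum-13193 · crux · rank 3 · closed · proved by Summit.AtomisticToContinuum.BoseEinsteinCondensation.Theorems.baseCoherentMass_proof @ dfc95003dd45 (prover) · by planner
why it might fail: only through constants: needs Λ(1−ε)^{-3} ≤ 4, i.e. MATCHED leading constants 4πa (cell-wise LY lower vs Dyson upper bound) plus monotone control of over-occupied cells, and a(v) < ∞ for hard cores; for v = 0 a.e. a separate free-gas argument with margin 0.73 vs 0.5 below the gap 3π²/L².
sources: LSSY2005, LiebYngvason1998, Dyson1957, BastiCenatiempoSchlein2021, Fournais2020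
[crux] COHERENT MASS AT A HEALING-TYPE BASE SCALE (card WindowBase moved down to ℓ_b ∼ ξ/10). For
every repulsive finite-range v and every ℓ_d > 0 there is ρ₀ > 0 such that for 0 < ρ < ρ₀ there is
ℓ_b ≥ ℓ_d with: for all large N there are a level K with L/2^K ∈ [ℓ_b, 2ℓ_b) and δ > 0 such that
every δ-near-minimiser has A_K ≥ √N/2, i.e. (8^{-K/2} Σ_B √n_B)² ≥ N/4 over the base cubes B. Route
to it: Σ_B n_B ≥ (1−ε)N by the Neumann Poincaré inequality in each cube against the kinetic energy ≤
E₀ + δ ≤ 4πaρN(1 + C(ρa³)^{1/3}) (Dyson–LSSY Dirichlet upper bound, PROVED in tree: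
eventually_groundStateEnergy_le_dyson), then (Σ√n_B)² ≥ (Σ n_B)³/Σ n_B² (Hölder) with the
anti-concentration Σ_B ⟨N_B⟩² ≤ Λ N² 8^{-K}, Λ(1−ε)^{-3} ≤ 4, from the cell-wise Lieb–Yngvason lower
bound (PROVED: LSSY2005_lowerBound_neumann_holds, cellDecomposition, superadditivity) against the
same upper bound; free gas (a = 0): A_K/√N → (2√2/π)³ ≈ 0.73. [difficulty: L] -/
@[route_item "route-AtomisticToContinuum-BECDyadicChaining", crux]
def BaseCoherentMass : Prop :=
  ∀ v : ℝ → ENNReal, Literature.MathematicalPhysics.QuantumManyBody.BoseGas.IsRepulsiveFiniteRange v → ∀ ℓd : ℝ, 0 < ℓd → ∃ ρ₀ : ℝ, 0 < ρ₀ ∧ ∀ ρ : ℝ, 0 < ρ → ρ < ρ₀ → ∃ ℓb : ℝ, ℓd ≤ ℓb ∧ ∀ᶠ N : ℕ in Filter.atTop, let L : ℝ := Literature.MathematicalPhysics.QuantumManyBody.BoseGas.sideLength ρ N; let φ : (m : ℕ) → (Fin 3 → Fin (2 ^ m)) → EuclideanSpace ℝ (Fin 3) → ℂ := fun m i => Set.indicator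 {x : EuclideanSpace ℝ (Fin 3) | ∀ k : Fin 3, x k ∈ Set.Ioo (((i k : ℕ) : ℝ) * (L / 2 ^ m)) ((((i k : ℕ) : ℝ) + 1) * (L / 2 ^ m))} (fun _ => ((Real.sqrt ((L / 2 ^ m) ^ 3))⁻¹ : ℂ)); ∃ K : ℕ, ℓb ≤ L / 2 ^ K ∧ L / 2 ^ K < 2 * ℓb ∧ ∃ δ : ENNReal, 0 < δ ∧ ∀ Ψ : Literature.MathematicalPhysics.QuantumManyBody.BoseGas.TrialState N L, Literature.MathematicalPhysics.QuantumManyBody.BoseGas.energy v Ψ ≤ Literature.MathematicalPhysics.QuantumManyBody.BoseGas.groundStateEnergy v N L + δ → (N : ENNReal) ^ (1 / 2 : ℝ) ≤ 2 * ((8 : ENNReal) ^ (-(K : ℝ) / 2) * ∑ i : Fin 3 → Fin (2 ^ K), (Literature.MathematicalPhysics.QuantumManyBody.BoseGas.occupation N (φ K i) Ψ.ψ) ^ (1 / 2 : ℝ))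

/-- item stmt-AtomisticToContinuum-13194 · crux · rank 4 · closed · moot by None · by planner
why it might fail: Fournais2020 Thm 1.2 (periodic, proved) and Junge2026 Cor 6 (Neumann, radially decreasing v, unproved in tree) tie ONE box to its own density at LHY precision; dyadic sub-cubes of a Dirichlet near-minimiser have fluctuating numbers and need cell-wise two-sided LHY bounds, not in print.
sources: Fournais2020, arXiv:2603.20776, FournaisEtAl2024, FournaisSolovej2020, FournaisSolovej2022, BastiCenatiempoSchlein2021
[crux] LOCAL CONDENSATION OF THE THERMODYNAMIC GROUND STATE ON ALL DYADIC SCALES UP TO THE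
FOURNAIS–JUNGE WINDOW (card engine (iii); the half of rank 2 that existing technology should reach;
not a hypothesis of `closes`). For every repulsive finite-range v (a = scattering length) and every
η ∈ (0, 1/4) there are γ > 2η, C ≥ 0 and ρ₀ > 0 such that for 0 < ρ < ρ₀, all large N, some δ > 0
and every δ-near-minimiser Ψ of the Dirichlet box of side L = (N/ρ)^{1/3}: for every level m with
cube side s = L/2^m ≤ (ρa)^{-1/2}(ρa³)^{-η}, Σ_{C ∈ level m} ⟨φ_C, γ_Ψ φ_C⟩ ≥ (1 − C(ρa³)^γ max(1, ρ
a s²)) N. Via Σ_C‖u_C‖ − ‖Σ_C u_C‖ ≤ √(8(N_P − n_P)) it yields the window part of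
DyadicCoherenceDefect with Σ_{window} β ≲ (ρa³)^{γ/2−η} + (ρa³)^{γ/2} log(1/ρ); below ξ the left
side increases under refinement, so the level s ≍ ξ suffices there. Vacuous (true) for a = 0.
[difficulty: XL] -/
@[route_item "route-AtomisticToContinuum-BECDyadicChaining"]
def WindowLocalCondensation : Prop :=
  ∀ v : ℝ → ENNReal, Literature.MathematicalPhysics.QuantumManyBody.BoseGas.IsRepulsiveFiniteRange v → ∀ η : ℝ, 0 < η → η < 1 / 4 → ∃ γ C : ℝ, 2 * η < γ ∧ 0 ≤ C ∧ ∃ ρ₀ : ℝ, 0 < ρ₀ ∧ ∀ ρ : ℝ, 0 < ρ → ρ < ρ₀ → ∀ᶠ N : ℕ in Filter.atTop, let a : ℝ := (Literature.MathematicalPhysics.QuantumManyBody.BoseGas.scatteringLength v).toReal; let L : ℝ := Literature.MathematicalPhysics.QuantumManyBody.BoseGas.sideLength ρ N; let φ : (m : ℕ) → (Fin 3 → Fin (2 ^ m)) → EuclideanSpace ℝ (Fin 3) → ℂ := fun m i => Set.indicator {x : EuclideanSpace ℝ (Fin 3) | ∀ k : Fin 3, x k ∈ Set.Ioo (((i k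 : ℕ) : ℝ) * (L / 2 ^ m)) ((((i k : ℕ) : ℝ) + 1) * (L / 2 ^ m))} (fun _ => ((Real.sqrt ((L / 2 ^ m) ^ 3))⁻¹ : ℂ)); ∃ δ : ENNReal, 0 < δ ∧ ∀ Ψ : Literature.MathematicalPhysics.QuantumManyBody.BoseGas.TrialState N L, Literature.MathematicalPhysics.QuantumManyBody.BoseGas.energy v Ψ ≤ Literature.MathematicalPhysics.QuantumManyBody.BoseGas.groundStateEnergy v N L + δ → ∀ m : ℕ, L / 2 ^ m ≤ (ρ * a) ^ (-(1 : ℝ) / 2) * (ρ * a ^ 3) ^ (-η) → ENNReal.ofReal ((1 - C * (ρ * a ^ 3) ^ γ * max 1 (ρ * a * (L / 2 ^ m) ^ 2)) * N) ≤ ∑ i : Fin 3 → Fin (2 ^ m), Literature.MathematicalPhysics.QuantumManyBody.BoseGas.occupation N (φ m i) Ψ.ψ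

/-- item stmt-AtomisticToContinuum-13195 · support · rank 9 · closed · proved by Summit.AtomisticToContinuum.BoseEinsteinCondensation.Theorems.coherentAmplitudeMonotone_proof (prover) · by planner
sources: LSSY2005, PenroseOnsager1956
[support] For every N, L, every Dirichlet trial state Ψ and every level m ≥ 1: A_{m−1} ≤ A_m (norm
of the sum ≤ sum of the norms for the eight child Gram vectors of each parent cube; needs the
L²(Λ^{N−1}) structure of `occupation`: u_φ(Y) = √N ∫ conj(φ) Ψ(·,Y), φ ↦ u_φ conjugate-linear,
occupation = ‖u_φ‖², and φ_P = 8^{-1/2} Σ_{C⊂P} φ_C a.e.). Establishes the Hilbert-space API every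
engine for rank 2 will use; not a hypothesis of `closes`. [difficulty: provable-now] -/
@[route_item "route-AtomisticToContinuum-BECDyadicChaining"]
def CoherentAmplitudeMonotone : Prop :=
  ∀ (N : ℕ) (L : ℝ) (Ψ : Literature.MathematicalPhysics.QuantumManyBody.BoseGas.TrialState N L) (m : ℕ), 1 ≤ m → let φ : (m : ℕ) → (Fin 3 → Fin (2 ^ m)) → EuclideanSpace ℝ (Fin 3) → ℂ := fun m i => Set.indicator {x : EuclideanSpace ℝ (Fin 3) | ∀ k : Fin 3, x k ∈ Set.Ioo (((i k : ℕ) : ℝ) * (L / 2 ^ m)) ((((i k : ℕ) : ℝ) + 1) * (L / 2 ^ m))} (fun _ => ((Real.sqrt ((L / 2 ^ m) ^ 3))⁻¹ : ℂ)); let A : ℕ → ENNReal := fun m => (8 : ENNReal) ^ (-(m : ℝ) / 2) * ∑ i : Fin 3 → Fin (2 ^ m), (Literature.MathematicalPhysics.QuantumManyBody.BoseGas.occupation N (φ m i) Ψ.ψ) ^ (1 / 2 : ℝ); A (m - 1) ≤ A m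

/-- item stmt-AtomisticToContinuum-14112 · support · rank 9 · closed · proved by Summit.AtomisticToContinuum.BoseEinsteinCondensation.Theorems.zeroModeOfChaining_proof @ 6c1eb9de17e9 (prover) · by planner
sources: LSSY2005, PenroseOnsager1956
[support] GLUE to the shared target (route-choice repair 2026-08-16, `route.target-unreachable`):
DyadicCoherenceDefect → BaseCoherentMass → ZeroModeOccupation (X_B1,
stmt-AtomisticToContinuum-0686). Fix v; take ℓ_d, ρ₀′, β from DyadicCoherenceDefect and ρ₀″, ℓ_b ≥
ℓ_d, K from BaseCoherentMass fed this ℓ_d; ρ₀ = min, δ = min(δ′, δ″), c = 1/16. For a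
δ-near-minimiser every level m ≤ K has cube side ≥ ℓ_b ≥ ℓ_d, so each m ≤ K has a dyadic bracket
j(m) (exists_nat_pow_near) with j(m)+m constant, j injective on {1,…,K}; telescoping the per-level
inequalities gives A_K ≤ A_0 + (Σ_{m≤K} β_{j(m)})√N ≤ A_0 + √N/4 (Finset.sum_image,
Summable.sum_le_tsum), and √N ≤ 2A_K gives √N ≤ 4A_0 in ℝ≥0∞; A_0 is the single level-0 term whose
cube is `box L` with weight (√(L³))⁻¹, so squaring yields ofReal(N/16) ≤ ⟨φ₀, γ_Ψ φ₀⟩. Proof = the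
body of the route's proved deciding theorem `closes` after its first step `bec_of_zeroMode` (planner
Sketch.lean: sorry-free, axioms propext/Classical.choice/Quot.sound — attached as evidence). [deps:
DyadicCoherenceDefect, BaseCoherentMass, ZeroModeOccupation] [difficulty: provable-now] -/
@[route_item "route-AtomisticToContinuum-BECDyadicChaining"]
def ZeroModeOfChaining : Prop :=
  DyadicCoherenceDefect → BaseCoherentMass → ZeroModeOccupation

/-- item stmt-AtomisticToContinuum-13196 · assembly · rank 1 · closed · proved by Summit.AtomisticToContinuum.BoseEinsteinCondensation.Theorems.becDyadicChaining_assembly_proof (prover) · by planner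
sources: LSSY2005, PenroseOnsager1956
[assembly] DyadicCoherenceDefect → BaseCoherentMass → BoseEinsteinCondensation (the sub-problem
Statement decl `_root_.BoseEinsteinCondensation`, by name); proof = `closes`. -/
@[route_item "route-AtomisticToContinuum-BECDyadicChaining"]
def Assembly : Prop :=
  DyadicCoherenceDefect → BaseCoherentMass → _root_.BoseEinsteinCondensation

/-! D-0027 §2.1 — DECIDING THEOREM (planner-authored via `route open/edit --closes-file`; by planner-plancard-AtomisticToContinuum-BoseEin-01530ea2-g2-0 2026-08-15T19:00:36Z) — ARCHIVED: route closed (exhausted) 2026-08-17T18:08:02Z; kept so importers keep building: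
its hypotheses are this route's items and its conclusion the sub-problem Statement (glue_lint), and it elaborates with this file. -/

@[closes "route-AtomisticToContinuum-BECDyadicChaining"] theorem closes (hD : DyadicCoherenceDefect) (hB : BaseCoherentMass) :
    _root_.BoseEinsteinCondensation := by
  classical
  refine _root_.AtomisticToContinuum.BECInfraredBound.bec_of_zeroMode ?_
  intro v hv
  obtain ⟨ℓd, hℓd, ρ₁, hρ₁, H1⟩ := hD v hv
  obtain ⟨ρ₂, hρ₂, H2⟩ := hB v hv ℓd hℓd
  refine ⟨min ρ₁ ρ₂, lt_min hρ₁ hρ₂, fun ρ hρ hρlt => ?_⟩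
  obtain ⟨β, hβ0, hβs, hβ4, E1⟩ := H1 ρ hρ (hρlt.trans_le (min_le_left _ _))
  obtain ⟨ℓb, hℓdb, E2⟩ := H2 ρ hρ (hρlt.trans_le (min_le_right _ _))
  refine ⟨1 / 16, by norm_num, ?_⟩
  filter_upwards [E1, E2] with N hN1 hN2
  obtain ⟨δ₁, hδ₁, HΨ1⟩ := hN1
  obtain ⟨K, hK1, hK2, δ₂, hδ₂, HΨ2⟩ := hN2
  clear E1 E2 H1 H2
  have hLnn : 0 ≤ Literature.MathematicalPhysics.QuantumManyBody.BoseGas.sideLength ρ N :=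
    Real.rpow_nonneg (div_nonneg (Nat.cast_nonneg _) hρ.le) _
  -- name the box side L (no local variable depends on it yet)
  generalize hLdef : Literature.MathematicalPhysics.QuantumManyBody.BoseGas.sideLength ρ N = L at HΨ1 HΨ2 hK1 hK2 hLnn ⊢
  refine ⟨min δ₁ δ₂, lt_min hδ₁ hδ₂, fun Ψ hΨ => ?_⟩
  have h1 := HΨ1 Ψ (hΨ.trans (add_le_add le_rfl (min_le_left _ _)))
  have h2 := HΨ2 Ψ (hΨ.trans (add_le_add le_rfl (min_le_right _ _)))
  clear HΨ1 HΨ2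
  -- abbreviations: block modes, coherent amplitudes, √N
  set φf : (m : ℕ) → (Fin 3 → Fin (2 ^ m)) → EuclideanSpace ℝ (Fin 3) → ℂ := fun m i =>
    Set.indicator {x : EuclideanSpace ℝ (Fin 3) | ∀ k : Fin 3, x k ∈ Set.Ioo (((i k : ℕ) : ℝ) * (L / 2 ^ m))
      ((((i k : ℕ) : ℝ) + 1) * (L / 2 ^ m))} (fun _ => ((Real.sqrt ((L / 2 ^ m) ^ 3))⁻¹ : ℂ)) with hφf
  set A : ℕ → ENNReal := fun m => (8 : ENNReal) ^ (-(m : ℝ) / 2) *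
    ∑ i : Fin 3 → Fin (2 ^ m), (Literature.MathematicalPhysics.QuantumManyBody.BoseGas.occupation N (φf m i) Ψ.ψ) ^ (1 / 2 : ℝ) with hA
  set S : ENNReal := (N : ENNReal) ^ (1 / 2 : ℝ) with hS
  have hSfin : S ≠ ⊤ := ENNReal.rpow_ne_top_of_nonneg (by norm_num) (ENNReal.natCast_ne_top N)
  have h2top : (2 : ENNReal) ≠ ⊤ := ENNReal.ofNat_ne_top
  -- elementary facts about the scales
  have hscale : ∀ m, m ≤ K → ℓd ≤ L / 2 ^ m := by
    intro m hm
    calc ℓd ≤ ℓb := hℓdb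
      _ ≤ L / 2 ^ K := hK1
      _ ≤ L / 2 ^ m := div_le_div_of_nonneg_left hLnn (pow_pos two_pos m) (pow_le_pow_right₀ one_le_two hm)
  -- the dyadic bracket j(m) of every level m ≤ K
  have hbr : ∀ m, m ≤ K → ∃ j : ℕ, ℓd * 2 ^ j ≤ L / 2 ^ m ∧ L / 2 ^ m < ℓd * 2 ^ (j + 1) := by
    intro m hm
    have hx : 1 ≤ L / 2 ^ m / ℓd := by
      rw [le_div_iff₀ hℓd, one_mul]; exact hscale m hm
    obtain ⟨j, hj1, hj2⟩ := exists_nat_pow_near hx one_lt_two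
    refine ⟨j, ?_, ?_⟩
    · have := (le_div_iff₀ hℓd).mp hj1
      linarith [mul_comm ((2 : ℝ) ^ j) ℓd]
    · have := (div_lt_iff₀ hℓd).mp hj2
      linarith [mul_comm ((2 : ℝ) ^ (j + 1)) ℓd]
  choose! jf hjf1 hjf2 using hbr
  -- j(m) + m is constant in m, hence j is injective on the levels ≤ K
  have hup : ∀ m, m ≤ K → (2 : ℝ) ^ (jf m + m) ≤ L / ℓd := by
    intro m hm
    rw [le_div_iff₀ hℓd]
    have := (le_div_iff₀ (pow_pos two_pos m)).mp (hjf1 m hm)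
    calc (2 : ℝ) ^ (jf m + m) * ℓd = ℓd * 2 ^ jf m * 2 ^ m := by rw [pow_add]; ring
      _ ≤ L := this
  have hlow : ∀ m, m ≤ K → L / ℓd < (2 : ℝ) ^ (jf m + m + 1) := by
    intro m hm
    rw [div_lt_iff₀ hℓd]
    have := (div_lt_iff₀ (pow_pos two_pos m)).mp (hjf2 m hm)
    calc L < ℓd * 2 ^ (jf m + 1) * 2 ^ m := this
      _ = (2 : ℝ) ^ (jf m + m + 1) * ℓd := by rw [pow_add, pow_add, pow_add]; ring
  have hle : ∀ m m', m ≤ K → m' ≤ K → jf m + m ≤ jf m' + m' := by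
    intro m m' hm hm'
    by_contra hcon
    have hcon' : jf m' + m' + 1 ≤ jf m + m := by omega
    have h3 : (2 : ℝ) ^ (jf m' + m' + 1) ≤ 2 ^ (jf m + m) := pow_le_pow_right₀ one_le_two hcon'
    exact absurd ((hup m hm).trans_lt (hlow m' hm')) (not_lt.mpr h3)
  have hinj : ∀ m ∈ Finset.Icc 1 K, ∀ m' ∈ Finset.Icc 1 K, jf m = jf m' → m = m' := by
    intro m hm m' hm' hjj
    rw [Finset.mem_Icc] at hm hm'
    have e1 := hle m m' hm.2 hm'.2
    have e2 := hle m' m hm'.2 hm.2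
    omega
  -- the budget spent on the levels 1..K is at most Σ β ≤ 1/4
  have hsumβ : ∑ m ∈ Finset.Icc 1 K, β (jf m) ≤ 1 / 4 := by
    rw [← Finset.sum_image hinj]
    exact (hβs.sum_le_tsum _ (fun j _ => hβ0 j)).trans hβ4
  -- abstract telescoping in ℝ≥0∞
  have tele : ∀ (A : ℕ → ENNReal) (b : ℕ → ENNReal) (S : ENNReal) (K : ℕ),
      (∀ m, 1 ≤ m → m ≤ K → A m ≤ A (m - 1) + b m * S) →
      A K ≤ A 0 + (∑ m ∈ Finset.Icc 1 K, b m) * S := by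
    intro A b S K h
    induction K with
    | zero => simp
    | succ K ih =>
      have ih' := ih (fun m hm hmK => h m hm (hmK.trans (Nat.le_succ K)))
      calc A (K + 1) ≤ A (K + 1 - 1) + b (K + 1) * S := h (K + 1) (Nat.succ_pos K) le_rfl
        _ = A K + b (K + 1) * S := by rw [Nat.add_sub_cancel]
        _ ≤ (A 0 + (∑ m ∈ Finset.Icc 1 K, b m) * S) + b (K + 1) * S := add_le_add ih' le_rfl
        _ = A 0 + (∑ m ∈ Finset.Icc 1 (K + 1), b m) * S := by
          rw [Finset.sum_Icc_succ_top (Nat.succ_le_succ (Nat.zero_le K)), add_mul, add_assoc]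
  -- the per-level inequalities of DyadicCoherenceDefect along the brackets
  have hstep : ∀ m, 1 ≤ m → m ≤ K → A m ≤ A (m - 1) + ENNReal.ofReal (β (jf m)) * S :=
    fun m hm hmK => h1 m (jf m) hm (hjf1 m hmK) (hjf2 m hmK)
  have hK : A K ≤ A 0 + (∑ m ∈ Finset.Icc 1 K, ENNReal.ofReal (β (jf m))) * S :=
    tele A (fun m => ENNReal.ofReal (β (jf m))) S K hstep
  have hsum' : (∑ m ∈ Finset.Icc 1 K, ENNReal.ofReal (β (jf m))) ≤ ENNReal.ofReal (1 / 4) := by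
    rw [← ENNReal.ofReal_sum_of_nonneg (fun m _ => hβ0 (jf m))]
    exact ENNReal.ofReal_le_ofReal hsumβ
  have hquarter : ENNReal.ofReal (1 / 4) = 4⁻¹ := by
    rw [one_div, ENNReal.ofReal_inv_of_pos (by norm_num : (0 : ℝ) < 4), ENNReal.ofReal_ofNat]
  have htwo : (2 : ENNReal) * 4⁻¹ = 2⁻¹ := by
    have h4 : (4 : ENNReal) = 2 * 2 := by norm_num
    rw [h4, ENNReal.mul_inv (Or.inl two_ne_zero) (Or.inl h2top), ← mul_assoc,
      ENNReal.mul_inv_cancel two_ne_zero h2top, one_mul]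
  -- BaseCoherentMass: √N ≤ 2 A_K; telescoping: A_K ≤ A_0 + √N/4
  have h2' : S ≤ 2 * A K := h2
  have hK' : A K ≤ A 0 + 4⁻¹ * S :=
    hK.trans (add_le_add le_rfl (hquarter ▸ mul_le_mul' hsum' le_rfl))
  have hmain : S ≤ 2 * A 0 + 2⁻¹ * S := by
    calc S ≤ 2 * A K := h2'
      _ ≤ 2 * (A 0 + 4⁻¹ * S) := mul_le_mul' le_rfl hK'
      _ = 2 * A 0 + 2⁻¹ * S := by rw [mul_add, ← mul_assoc (2 : ENNReal) 4⁻¹ S, htwo]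
  have hhalf : 2⁻¹ * S + 2⁻¹ * S = S := by
    rw [← two_mul, ← mul_assoc, ENNReal.mul_inv_cancel two_ne_zero h2top, one_mul]
  have hS2 : 2⁻¹ * S ≤ 2 * A 0 := by
    have : 2⁻¹ * S + 2⁻¹ * S ≤ 2 * A 0 + 2⁻¹ * S := by rw [hhalf]; exact hmain
    exact (ENNReal.add_le_add_iff_right (ENNReal.mul_ne_top (ENNReal.inv_ne_top.mpr two_ne_zero) hSfin)).mp this
  have hS4 : S ≤ 4 * A 0 := by
    calc S = 2 * (2⁻¹ * S) := by
          rw [← mul_assoc, ENNReal.mul_inv_cancel two_ne_zero h2top, one_mul]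
      _ ≤ 2 * (2 * A 0) := mul_le_mul' le_rfl hS2
      _ = 4 * A 0 := by rw [← mul_assoc]; norm_num
  -- level 0 is the single cube (0,L)³ with the normalised constant mode
  obtain ⟨i₀, hi₀⟩ : ∃ i₀ : Fin 3 → Fin (2 ^ 0), ∀ k, ((i₀ k : ℕ) : ℝ) = 0 :=
    ⟨fun _ => ⟨0, by norm_num⟩, fun _ => by simp⟩
  have hsub : Subsingleton (Fin 3 → Fin (2 ^ 0)) := by rw [pow_zero]; infer_instance
  have hA0 : A 0 = (Literature.MathematicalPhysics.QuantumManyBody.BoseGas.occupation N (φf 0 i₀) Ψ.ψ) ^ (1 / 2 : ℝ) := by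
    have e1 : A 0 = (8 : ENNReal) ^ (-((0 : ℕ) : ℝ) / 2) *
        ∑ i : Fin 3 → Fin (2 ^ 0), (Literature.MathematicalPhysics.QuantumManyBody.BoseGas.occupation N (φf 0 i) Ψ.ψ) ^ (1 / 2 : ℝ) := rfl
    rw [e1, Fintype.sum_subsingleton _ i₀]
    simp only [Nat.cast_zero, neg_zero, zero_div, ENNReal.rpow_zero, one_mul]
  have hφ0 : φf 0 i₀ = (Literature.MathematicalPhysics.QuantumManyBody.BoseGas.box L).indicator
      (fun _ => ((Real.sqrt (L ^ 3))⁻¹ : ℂ)) := by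
    have hset : {x : EuclideanSpace ℝ (Fin 3) | ∀ k : Fin 3, x k ∈ Set.Ioo (((i₀ k : ℕ) : ℝ) * (L / 2 ^ 0))
        ((((i₀ k : ℕ) : ℝ) + 1) * (L / 2 ^ 0))} = Literature.MathematicalPhysics.QuantumManyBody.BoseGas.box L := by
      ext x
      simp [Literature.MathematicalPhysics.QuantumManyBody.BoseGas.box]
    have hnorm : ((Real.sqrt ((L / 2 ^ 0) ^ 3))⁻¹ : ℂ) = ((Real.sqrt (L ^ 3))⁻¹ : ℂ) := by
      rw [pow_zero, div_one]
    show Set.indicator {x : EuclideanSpace ℝ (Fin 3) | ∀ k : Fin 3, x k ∈ Set.Ioo (((i₀ k : ℕ) : ℝ) * (L / 2 ^ 0))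
        ((((i₀ k : ℕ) : ℝ) + 1) * (L / 2 ^ 0))} (fun _ => ((Real.sqrt ((L / 2 ^ 0) ^ 3))⁻¹ : ℂ)) = _
    rw [hset, hnorm]
  -- conclusion: N ≤ 16 · occupation of the constant mode
  set occ₀ := Literature.MathematicalPhysics.QuantumManyBody.BoseGas.occupation N
    ((Literature.MathematicalPhysics.QuantumManyBody.BoseGas.box L).indicator (fun _ => ((Real.sqrt (L ^ 3))⁻¹ : ℂ))) Ψ.ψ with hocc₀
  have hroot : S ≤ 4 * occ₀ ^ (1 / 2 : ℝ) := by rw [hocc₀, ← hφ0, ← hA0]; exact hS4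
  have hN16 : (N : ENNReal) ≤ 16 * occ₀ := by
    have hsq := ENNReal.rpow_le_rpow hroot (by norm_num : (0 : ℝ) ≤ 2)
    have eS : S ^ (2 : ℝ) = (N : ENNReal) := by
      rw [hS, ← ENNReal.rpow_mul]; norm_num
    have eR : (4 * occ₀ ^ (1 / 2 : ℝ)) ^ (2 : ℝ) = 16 * occ₀ := by
      rw [ENNReal.mul_rpow_of_nonneg _ _ (by norm_num : (0 : ℝ) ≤ 2), ← ENNReal.rpow_mul]
      have h16 : (4 : ENNReal) ^ (2 : ℝ) = 16 := by
        rw [show (2 : ℝ) = ((2 : ℕ) : ℝ) by norm_num, ENNReal.rpow_natCast]; norm_num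
      rw [h16]; norm_num
    rwa [eS, eR] at hsq
  calc ENNReal.ofReal (1 / 16 * (N : ℝ)) = 16⁻¹ * (N : ENNReal) := by
        rw [ENNReal.ofReal_mul (by norm_num), ENNReal.ofReal_natCast, one_div,
          ENNReal.ofReal_inv_of_pos (by norm_num : (0 : ℝ) < 16), ENNReal.ofReal_ofNat]
    _ ≤ 16⁻¹ * (16 * occ₀) := mul_le_mul' le_rfl hN16
    _ = occ₀ := by
        rw [← mul_assoc, ENNReal.inv_mul_cancel (by norm_num) (by norm_num), one_mul]

end Summit.AtomisticToContinuum.BoseEinsteinCondensation.Theses.BECDyadicChaining
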